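import Summits.QuantumFields.BalabanUV.Beta.GAN24.DerivativeRateTransferJensenMassFreeKarcherPhase

/-!
# `BalabanUV.Beta.GAN24.DerivativeRateTransferJensenMassFreePolarPhase` — binder row G-an2-4 ∕ (CONV-C), route R6 «VALUES, NOT DERIVATIVES», PART 87:
# BAŁABAN–JAFFE's «SLIGHTLY MODIFIED POLAR DECOMPOSITION», TYPED — [Erice 1985 p. 221, (1.26)]: «`Proj X` is uniquely defined for nonsingular `X` by a slightly
# modified polar decomposition of `X`.  Write `X = Ue^{iθ}H` where `U ∈ SU(N)`, `θ ∈ ℝ` and `H` is Hermitian. `Proj X = U`.»  In the lineage's realified language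
# (complex structure `J`: `JᵀJ = 1`, `Jᵀ = −J`; `e^{iθ} = exp(θJ)`; «special-unitary relative to `τ₀`» = the small logarithm of `·τ₀ᵀ` has `J`-trace zero):
# for a `J`-commuting polar link `R′` of special-unitary contour variables the phase is `c = tr(J·log(R′τ₀ᵀ))∕dim`, the corrected link `Proj = exp(cJ)·R′` is
# orthogonal, `J`-commuting and SPECIAL-UNITARY relative to `τ₀`, and — because the Karcher base carries no phase (PART 86) — the correction is THIRD ORDER:
#   `‖Proj − R′‖ ≤ 4‖R′ − V‖ ≤ 4(1280D³ + 200704D⁴)`,  `‖Proj − V‖ ≤ 5(1280D³ + 200704D⁴)`  (unit b2b-balaban-gan24-p3, gen 46; v1)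

NOT IN PRINT; OUR PROOF (for the ROUTE; PART 86 `karcher_phase_of_transports`, PART 77 `frob_norm_polar_sub_karcher_le`, PART 73 `commute_log_of_commute`, PART 69
`exists_skew_log_of_orthogonal` ∕ `norm_sub_le_two_mul_norm_exp_sub`, PART 79 `abs_trace_tmul_le`, PART 66's Frobenius toolkit BY NAME).  HONEST FRAMING (cell
contract, verbatim): «discharging `BetaPertH` makes Bałaban's UV stability UNCONDITIONAL — a real constructive-QFT result; it is NOT the continuum limit and NOT the
Clay problem.»  HONEST DEPENDENCY (verbatim): «continuum YM on T⁴ ⇐ BetaPertH ∧ nine spine estimates (0/9 proved); BetaPertH ⇐ (D1) ∧ (D4) ∧ CAP+tail; G-an2-4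
gates asym, D1 and NE2/3/4.»

WHAT THIS FILE PROVES (0 sorry, 0 `def`, nothing cited): `frob_norm_complexStructure` (`‖J‖ = √dim`), `trace_J_sq` (`tr(J·J) = −dim`), `norm_phase_smul_le`
(`‖(tr(JX)∕dim)•J‖ ≤ ‖X‖`), **`polar_phase_of_transports`** (the statement above, for every `J`-commuting polar link `R′`).  HONEST SCOPE: realified surrogate of
`SU(N)` (`J`-trace of the small logarithm relative to `τ₀`); `Proj` is no longer a polar link of the mean (it is Bałaban–Jaffe's `Proj`); windows of PART 86
(`D ≤ 1∕800`), crude constants; ONE scale; NOT the tower, NOT (CONS), NOT (CONV-C).  SUPPLIER work on route R6 (rank 2, REDUCTION, no seat); no consumer of record;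
NEVER «G-an2-4 closed»; NOT (CONV-C), NOT D1, NOT `BetaPertH`, NOT continuum, NOT Clay.  Records: `HOME/b2b-balaban-gan24-p3/WOODBURY-FIBRE.md` v14.6. -/

noncomputable section

open scoped Matrix Matrix.Norms.Frobenius NNReal
open NormedSpace Finset Matrix Metric Set

namespace Summit.QuantumFields.BalabanUV.Beta.GAN24.DerivativeRateTransferJensenMassFreePolarPhase

open Summit.QuantumFields.BalabanUV.Beta.GAN24.DerivativeRateTransferJensenMassFreePolarNear
open Summit.QuantumFields.BalabanUV.Beta.GAN24.DerivativeRateTransferJensenMassFreeExpTaylor (orthogonal_exp_of_skew transpose_exp_of_skew norm_exp_sub_one_le)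
open Summit.QuantumFields.BalabanUV.Beta.GAN24.DerivativeRateTransferJensenMassFreeLogarithm
open Summit.QuantumFields.BalabanUV.Beta.GAN24.DerivativeRateTransferJensenMassFreeLogarithmCommute
open Summit.QuantumFields.BalabanUV.Beta.GAN24.DerivativeRateTransferJensenMassFreeKarcherContraction
open Summit.QuantumFields.BalabanUV.Beta.GAN24.DerivativeRateTransferJensenMassFreeKarcherEquation
open Summit.QuantumFields.BalabanUV.Beta.GAN24.DerivativeRateTransferJensenMassFreeKarcherGauss (abs_trace_tmul_le)
open Summit.QuantumFields.BalabanUV.Beta.GAN24.DerivativeRateTransferJensenMassFreeKarcherPhase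

variable {o ν : Type*} [Fintype o] [DecidableEq o] [Fintype ν]

/-! ## §1 The complex structure in the Frobenius norm -/

omit [Fintype ν] in
/-- `‖J‖ = √(dim)` for an orthogonal `J` (Frobenius). [folklore] -/
theorem frob_norm_complexStructure {J : Matrix o o ℝ} (hJ : Jᵀ * J = 1) : ‖J‖ = Real.sqrt (Fintype.card o) := by
  have h : ‖J‖ ^ 2 = Fintype.card o := by rw [← trace_transpose_mul_self, hJ, Matrix.trace_one]
  rw [← h, Real.sqrt_sq (norm_nonneg _)]

omit [Fintype ν] in
/-- `tr(J·J) = −dim` for a complex structure (`JᵀJ = 1`, `Jᵀ = −J`). [folklore] -/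
theorem trace_J_sq {J : Matrix o o ℝ} (hJ : Jᵀ * J = 1) (hJt : Jᵀ = -J) : Matrix.trace (J * J) = -(Fintype.card o : ℝ) := by
  have h : J * J = -1 := by
    have e : -(J * J) = 1 := by rw [← Matrix.neg_mul, ← hJt, hJ]
    rw [← neg_neg (J * J), e]
  rw [h, Matrix.trace_neg, Matrix.trace_one]

omit [Fintype ν] in
/-- the phase generator is no larger than its source: `‖(tr(JX)∕dim)•J‖ ≤ ‖X‖` for orthogonal `J`. [folklore] -/
theorem norm_phase_smul_le {J : Matrix o o ℝ} (hJ : Jᵀ * J = 1) (X : Matrix o o ℝ) :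
    ‖(Matrix.trace (J * X) / Fintype.card o) • J‖ ≤ ‖X‖ := by
  have htr : |Matrix.trace (J * X)| ≤ ‖J‖ * ‖X‖ := by
    have h := abs_trace_tmul_le Jᵀ X
    rwa [transpose_transpose, Matrix.frobenius_norm_transpose] at h
  rw [norm_smul, Real.norm_eq_abs, abs_div, Nat.abs_cast, frob_norm_complexStructure hJ] at *
  rcases Nat.eq_zero_or_pos (Fintype.card o) with h0 | hpos
  · rw [h0]; simp
  · have hn : (0 : ℝ) < Fintype.card o := by exact_mod_cast hpos
    have hs : Real.sqrt (Fintype.card o) * Real.sqrt (Fintype.card o) = Fintype.card o := Real.mul_self_sqrt hn.le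
    calc |Matrix.trace (J * X)| / (Fintype.card o : ℝ) * Real.sqrt (Fintype.card o)
        ≤ Real.sqrt (Fintype.card o) * ‖X‖ / (Fintype.card o : ℝ) * Real.sqrt (Fintype.card o) := by gcongr
      _ = ‖X‖ * ((Real.sqrt (Fintype.card o) * Real.sqrt (Fintype.card o)) / Fintype.card o) := by ring
      _ = ‖X‖ := by rw [hs, div_self hn.ne', mul_one]

/-! ## §2 The phase of a polar link of special-unitary contour variables is third order -/

omit [Fintype ν] in
/-- arithmetic of the window: `0 ≤ D ≤ 1∕800` ⟹ `1280D³ + 200704D⁴ ≤ D∕400`. -/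
theorem tauK_le {D : ℝ} (hD0 : 0 ≤ D) (hD800 : D ≤ 1 / 800) : 1280 * D ^ 3 + 200704 * D ^ 4 ≤ D / 400 := by
  have h2 : D ^ 2 ≤ D * (1 / 800) := by nlinarith
  have h3 : D ^ 3 ≤ D * (1 / 800) ^ 2 := by nlinarith
  have h4 : D ^ 4 ≤ D * (1 / 800) ^ 3 := by nlinarith
  nlinarith

omit [DecidableEq o] [Fintype ν] in
/-- the trace of a matrix over an empty index type vanishes. [folklore] -/
theorem trace_eq_zero_of_card_eq_zero (h0 : Fintype.card o = 0) (X : Matrix o o ℝ) : Matrix.trace X = 0 := by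
  haveI : IsEmpty o := Fintype.card_eq_zero_iff.mp h0
  simp [Matrix.trace]

/-- **`polar_phase_of_transports` — BAŁABAN–JAFFE's MODIFIED `Proj`: THE PHASE OF A POLAR LINK IS THIRD ORDER** [our proof].  PART 86's setting (weights, orthogonal
transports within `D ≤ 1∕800` of `τ₀`, a COMPLEX STRUCTURE `J` (`JᵀJ = 1`, `Jᵀ = −J`) commuting with the data, data special-unitary relative to `τ₀`).  THEN, with
the Karcher base `V` (special-unitary relative to `τ₀`, PART 86), for EVERY `J`-commuting polar link `R′` of `Σ_x q_x•τ_x` there is a skew `J`-commuting logarithm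
`P` of `R′τ₀ᵀ` such that the phase-corrected link `Proj := exp((tr(J·P)∕dim)•J)·R′` is orthogonal, commutes with `J`, is SPECIAL-UNITARY relative to `τ₀` (every
small logarithm of `Proj·τ₀ᵀ` has `J`-trace zero), and `‖Proj − R′‖ ≤ 4‖R′ − V‖ ≤ 4(1280D³ + 200704D⁴)`, `‖Proj − V‖ ≤ 5(1280D³ + 200704D⁴)`.  DICTIONARY
(gan24-idea-1 g62, W-2): for the realified `P`, `tr(J·P) = −2·Im tr_ℂ log(R′τ₀ᵀ) = −2·arg det_ℂ(R′τ₀ᵀ)` and `dim = 2N`, so `c = −arg det∕N = −θ` and `Proj = e^{−iθ}R′` is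
Bałaban–Jaffe's `U` in `X = Ue^{iθ}H`; their LEFT unitary factor and the lineage's right-handed polar link coincide (`X = UP = (UPU*)U`). -/
theorem polar_phase_of_transports {q : ν → ℝ} (hq : ∀ x, 0 ≤ q x) (hq1 : ∑ x, q x = 1) {τ : ν → Matrix o o ℝ} {τ₀ J : Matrix o o ℝ}
    (hτ : ∀ x, (τ x)ᵀ * τ x = 1) (hτ₀ : τ₀ᵀ * τ₀ = 1) {D : ℝ} (hD : ∀ x, ‖τ x * τ₀ᵀ - 1‖ ≤ D) (hD800 : D ≤ 1 / 800)
    (hJ : Jᵀ * J = 1) (hJt : Jᵀ = -J) (hJτ : ∀ x, Commute J (τ x)) (hJτ₀ : Commute J τ₀)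
    (hsu : ∀ x (A : Matrix o o ℝ), ‖A‖ ≤ 1 / 4 → exp A = τ x * τ₀ᵀ → Matrix.trace (J * A) = 0) :
    ∃ (V : Matrix o o ℝ) (C : ν → Matrix o o ℝ), Vᵀ * V = 1 ∧ (∀ x, exp (C x) * V = τ x) ∧ ∑ x, q x • C x = 0 ∧
      (∀ B : Matrix o o ℝ, ‖B‖ ≤ 1 / 4 → exp B = V * τ₀ᵀ → Matrix.trace (J * B) = 0) ∧
      ∀ R' : Matrix o o ℝ, R'ᵀ * R' = 1 → ((∑ x, q x • τ x) * R'ᵀ)ᵀ = (∑ x, q x • τ x) * R'ᵀ →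
        (∀ w : o → ℝ, 0 ≤ w ⬝ᵥ (((∑ x, q x • τ x) * R'ᵀ) *ᵥ w)) → Commute J R' →
        ∃ P : Matrix o o ℝ, Pᵀ = -P ∧ ‖P‖ ≤ 1 / 4 ∧ exp P = R' * τ₀ᵀ ∧ Commute J P ∧
          (exp ((Matrix.trace (J * P) / Fintype.card o) • J) * R')ᵀ * (exp ((Matrix.trace (J * P) / Fintype.card o) • J) * R') = 1 ∧
          Commute J (exp ((Matrix.trace (J * P) / Fintype.card o) • J) * R') ∧
          ‖exp ((Matrix.trace (J * P) / Fintype.card o) • J) * R' - R'‖ ≤ 4 * ‖R' - V‖ ∧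
          ‖R' - V‖ ≤ 1280 * D ^ 3 + 200704 * D ^ 4 ∧
          ‖exp ((Matrix.trace (J * P) / Fintype.card o) • J) * R' - V‖ ≤ 5 * (1280 * D ^ 3 + 200704 * D ^ 4) ∧
          ∀ B : Matrix o o ℝ, ‖B‖ ≤ 1 / 4 → exp B = exp ((Matrix.trace (J * P) / Fintype.card o) • J) * R' * τ₀ᵀ → Matrix.trace (J * B) = 0 := by
  obtain ⟨V, C, hV, hV1, hCt, hCe, hC8, h0, hJV, -, -, hVsu⟩ := karcher_phase_of_transports hq hq1 hτ hτ₀ hD hD800 hJ hJτ hJτ₀ hsu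
  have hD0 : 0 ≤ D := by
    obtain ⟨x, -, -⟩ : ∃ x ∈ (Finset.univ : Finset ν), q x ≠ 0 := Finset.exists_ne_zero_of_sum_ne_zero (by rw [hq1]; exact one_ne_zero)
    exact (norm_nonneg _).trans (hD x)
  have hτK := tauK_le hD0 hD800
  have hτ₀' : τ₀ * τ₀ᵀ = 1 := mul_eq_one_comm.mp hτ₀
  have hJτ₀t : Commute J τ₀ᵀ := commute_transpose_of_orthogonal hτ₀ hJτ₀
  refine ⟨V, C, hV, hCe, h0, hVsu, fun R' hR' hsym hpsd hJR' => ?_⟩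
  -- the polar bound
  have hRV : ‖R' - V‖ ≤ 1280 * D ^ 3 + 200704 * D ^ 4 := by
    have h := frob_norm_polar_sub_karcher_le hq hq1 hV hCt hC8 (by linarith) hCe h0 hR' hsym hpsd
    rwa [eight_mul_cube_eq] at h
  -- the loop `R′τ₀ᵀ` and its logarithm `P`
  have horth : ∀ W : Matrix o o ℝ, Wᵀ * W = 1 → (W * τ₀ᵀ)ᵀ * (W * τ₀ᵀ) = 1 := fun W hW => by
    rw [transpose_mul, transpose_transpose, Matrix.mul_assoc, ← Matrix.mul_assoc Wᵀ, hW, Matrix.one_mul, hτ₀']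
  have hRVτ : ‖R' * τ₀ᵀ - V * τ₀ᵀ‖ = ‖R' - V‖ := by
    rw [← Matrix.sub_mul, frob_norm_mul_orthogonal _ (by rw [transpose_transpose]; exact hτ₀)]
  have hR9 : ‖R' * τ₀ᵀ - 1‖ ≤ 9 * D := by
    have e : R' * τ₀ᵀ - 1 = (R' * τ₀ᵀ - V * τ₀ᵀ) + (V * τ₀ᵀ - 1) := by abel
    rw [e]
    refine (norm_add_le _ _).trans ?_
    rw [hRVτ]
    linarith
  have hR1 : ‖R' * τ₀ᵀ - 1‖ ≤ 1 / 8 := hR9.trans (by linarith)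
  obtain ⟨P, hPt, hP4, hP2, hPe⟩ := exists_skew_log_of_orthogonal (horth R' hR') hR1
  have hP18 : ‖P‖ ≤ 18 * D := hP2.trans (by linarith)
  have hJP : Commute J P := commute_log_of_commute hJ (hJR'.mul_right hJτ₀t) hP4 hPe
  obtain ⟨B, hBt, hB4, -, hBe⟩ := exists_skew_log_of_orthogonal (horth V hV) (hV1.trans (by linarith))
  have hB0 : Matrix.trace (J * B) = 0 := hVsu B hB4 hBe
  have hPB : ‖P - B‖ ≤ 2 * ‖R' - V‖ := by
    -- re-ascribed along this file's instance path before rewriting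
    have h : ‖P - B‖ ≤ 2 * ‖exp P - exp B‖ := norm_sub_le_two_mul_norm_exp_sub hP4 hB4
    rwa [hPe, hBe, hRVτ] at h
  have htrP : Matrix.trace (J * P) = Matrix.trace (J * (P - B)) := by rw [Matrix.mul_sub, Matrix.trace_sub, hB0, sub_zero]
  -- the phase generator `cJ`
  set c : ℝ := Matrix.trace (J * P) / Fintype.card o with hc
  have hcJ : ‖c • J‖ ≤ 2 * ‖R' - V‖ := by
    rw [hc, htrP]; exact (norm_phase_smul_le hJ (P - B)).trans hPB
  have hcJt : (c • J)ᵀ = -(c • J) := by rw [transpose_smul, hJt, smul_neg]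
  have hcJ1 : ‖c • J‖ ≤ 1 := hcJ.trans (by linarith)
  have hexpo : (exp (c • J))ᵀ * exp (c • J) = 1 := orthogonal_exp_of_skew hcJt
  have hcomm : Commute (c • J) P := hJP.smul_left c
  have hexp1 : ‖exp (c • J) - 1‖ ≤ 2 * ‖c • J‖ := norm_exp_sub_one_le _ hcJ1
  have hER : ‖(exp (c • J) - 1) * R'‖ = ‖exp (c • J) - 1‖ := frob_norm_mul_orthogonal _ (mul_eq_one_comm.mp hR')
  refine ⟨P, hPt, hP4, hPe, hJP, ?_, ?_, ?_, hRV, ?_, ?_⟩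
  · rw [transpose_mul, Matrix.mul_assoc, ← Matrix.mul_assoc (exp (c • J))ᵀ, hexpo, Matrix.one_mul, hR']
  · exact (Commute.exp_right ((Commute.refl J).smul_right c)).mul_right hJR'
  · have e : exp (c • J) * R' - R' = (exp (c • J) - 1) * R' := by rw [Matrix.sub_mul, Matrix.one_mul]
    rw [e, hER]
    linarith
  · have e : exp (c • J) * R' - V = (exp (c • J) - 1) * R' + (R' - V) := by rw [Matrix.sub_mul, Matrix.one_mul]; abel
    rw [e]
    refine (norm_add_le _ _).trans ?_
    rw [hER]
    linarith
  · intro B' hB'4 hB'e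
    -- the small logarithm of `Proj·τ₀ᵀ` is `cJ + P`
    have hQe : exp (c • J + P) = exp (c • J) * R' * τ₀ᵀ := by
      rw [Matrix.exp_add_of_commute _ _ hcomm, hPe, Matrix.mul_assoc]
    have hQ4 : ‖c • J + P‖ ≤ 1 / 4 := by
      refine (norm_add_le _ _).trans ?_
      linarith
    have e : B' = c • J + P := log_unique hB'4 hQ4 (hB'e.trans hQe.symm)
    rw [e, Matrix.mul_add, Matrix.trace_add, Matrix.mul_smul, Matrix.trace_smul, smul_eq_mul, trace_J_sq hJ hJt, hc]
    rcases Nat.eq_zero_or_pos (Fintype.card o) with h0' | hpos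
    · rw [trace_eq_zero_of_card_eq_zero h0' (J * P)]; simp
    · have hn : (Fintype.card o : ℝ) ≠ 0 := by exact_mod_cast hpos.ne'
      field_simp
      ring

end Summit.QuantumFields.BalabanUV.Beta.GAN24.DerivativeRateTransferJensenMassFreePolarPhase

end
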